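/-
Copyright: harness cell b2b-lgcu-borel (gen 13).  Honest framing: the VALUE here is a THEOREM (the
decorated-Sylow packing law of `DecoratedSylowLaw` is attained in every `GL₂(𝔽_p)`) — NOT summit
progress; the crux item `SubgroupIdentityDesigns` (stmt-MatrixMultiplication-14079) stays open.
-/
import Summits.MatrixMultiplication.MatrixMultiplication.Theorems.SubgroupIdentityDesigns.Negative.DecoratedSylowLaw

/-!
# The decorated-Sylow law `|H₁||H₂||H₃| ≤ p³(p-1)` is sharp in every `GL₂(𝔽_p)`

`DecoratedSylowLaw.decoratedSylow_volume_le`: subgroup-TPP triples with `U_{xᵢ} ≤ Hᵢ ≤ B_{xᵢ}` at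
the points `[e₀], [e₀+e₁], [e₁]` have `|H₁||H₂||H₃| ≤ p³(p-1)`.  Here (`decoratedSylow_volume_sharp`)
we exhibit, for EVERY prime `p`, a triple in exactly that hypothesis class attaining the bound:
`H₁ = {[[a, b], [0, 1]]}` (the affine group, order `p(p-1)`), `H₂ = U_{[e₀+e₁]} =
{[[1-t, t], [-t, 1+t]]}` and `H₃ = U_{[e₁]} = {[[1, 0], [y, 1]]}` (order `p` each); the TPP is the
entry computation `(a·b)₁₁ = 1 + t`.  So the census maxima `500, 2058, 13310` at `p = 5, 7, 11`
(report `run/shared/lean/b2b/levelgraded-cu/ORACLE-g13.md` §G13-3) are instances of an all-`p`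
family, and the constant in the law cannot be lowered.  By `DecoratedSylowNoGo` none of these
triples is a level-one witness of the crux for `ε ≤ 1`.  Sorry-free; the three subgroups are built
inside the proofs (no new top-level definitions).
-/

set_option linter.dupNamespace false

noncomputable section

open scoped BigOperators Classical
open Summit.MatrixMultiplication.MatrixMultiplication.Theorems.LieRankDesigns.Negative (GLm Mat)

namespace Summit.MatrixMultiplication.MatrixMultiplication.Theorems.SubgroupIdentityDesigns.Negative

section DecoratedSylowSharp

open Literature.Barriers.MatrixMultiplication (SubgroupTPP)

variable {p : ℕ} [hp : Fact p.Prime]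

/-- The affine group `{[[a, b], [0, 1]]} ≤ GL₂(𝔽_p)` (so `U_{[e₀]} ≤ H ≤ B_{[e₀]}`), of order
`p(p-1)`. -/
theorem exists_affine_subgroup :
    ∃ H : Subgroup (GLm p 2),
      (∀ g : GLm p 2, g ∈ H ↔ (g : Mat p 2) 1 0 = 0 ∧ (g : Mat p 2) 1 1 = 1) ∧
      Nat.card H = p * (p - 1) := by
  obtain ⟨e00, e01, e10, e11⟩ := gl2_one_apply (p := p)
  let H : Subgroup (GLm p 2) :=
    { carrier := {g | (g : Mat p 2) 1 0 = 0 ∧ (g : Mat p 2) 1 1 = 1}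
      mul_mem' := by
        rintro a b ⟨ha0, ha1⟩ ⟨hb0, hb1⟩
        show ((a * b : GLm p 2) : Mat p 2) 1 0 = 0 ∧ ((a * b : GLm p 2) : Mat p 2) 1 1 = 1
        rw [gl2_mul_apply, gl2_mul_apply, ha0, ha1, hb0, hb1]
        constructor <;> ring
      one_mem' := ⟨e10, e11⟩
      inv_mem' := by
        rintro g ⟨hg0, hg1⟩
        show ((g⁻¹ : GLm p 2) : Mat p 2) 1 0 = 0 ∧ ((g⁻¹ : GLm p 2) : Mat p 2) 1 1 = 1
        have hdet := FamilyADesign.det_ne g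
        rw [hg0, hg1, mul_one, mul_zero, sub_zero] at hdet
        have h10 := gl2_mul_apply g⁻¹ g 1 0
        rw [inv_mul_cancel, e10, hg0, mul_zero, add_zero] at h10
        have hi0 : ((g⁻¹ : GLm p 2) : Mat p 2) 1 0 = 0 := by
          rcases mul_eq_zero.1 h10.symm with h | h
          · exact h
          · exact absurd h hdet
        have h11 := gl2_mul_apply g⁻¹ g 1 1
        rw [inv_mul_cancel, e11, hi0, hg1, zero_mul, zero_add, mul_one] at h11
        exact ⟨hi0, h11.symm⟩ }
  have hmem : ∀ g : GLm p 2, g ∈ H ↔ (g : Mat p 2) 1 0 = 0 ∧ (g : Mat p 2) 1 1 = 1 :=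
    fun g => Iff.rfl
  refine ⟨H, hmem, ?_⟩
  have hne : ∀ g : H, ((g : GLm p 2) : Mat p 2) 0 0 ≠ 0 := by
    intro g
    have hg : ((g : GLm p 2) : Mat p 2) 1 0 = 0 ∧ ((g : GLm p 2) : Mat p 2) 1 1 = 1 := g.2
    have hdet := FamilyADesign.det_ne (g : GLm p 2)
    rw [hg.1, hg.2, mul_one, mul_zero, sub_zero] at hdet
    exact hdet
  let f : H → (ZMod p)ˣ × ZMod p := fun g => (Units.mk0 _ (hne g), ((g : GLm p 2) : Mat p 2) 0 1)
  have hf : Function.Bijective f := by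
    constructor
    · intro g h hgh
      have hg : ((g : GLm p 2) : Mat p 2) 1 0 = 0 ∧ ((g : GLm p 2) : Mat p 2) 1 1 = 1 := g.2
      have hh : ((h : GLm p 2) : Mat p 2) 1 0 = 0 ∧ ((h : GLm p 2) : Mat p 2) 1 1 = 1 := h.2
      have h1 := congrArg (fun q : (ZMod p)ˣ × ZMod p => ((q.1 : (ZMod p)ˣ) : ZMod p)) hgh
      have h2 := congrArg Prod.snd hgh
      simp only [f, Units.val_mk0] at h1 h2
      apply Subtype.ext
      exact gl2_ext h1 h2 (by rw [hg.1, hh.1]) (by rw [hg.2, hh.2])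
    · rintro ⟨a, b⟩
      obtain ⟨g, h00, h01, h10, h11⟩ := exists_gl2 (a : ZMod p) b 0 1
        (by rw [mul_one, mul_zero, sub_zero]; exact a.ne_zero)
      refine ⟨⟨g, (hmem g).2 ⟨h10, h11⟩⟩, Prod.ext (Units.ext ?_) ?_⟩
      · simp only [f, Units.val_mk0]
        exact h00
      · simp only [f]
        exact h01
  rw [Nat.card_eq_of_bijective f hf, Nat.card_prod, natCard_units, Nat.card_zmod, mul_comm]

/-- The unipotent radical `U_{[e₀+e₁]} = {[[1-t, t], [-t, 1+t]]}` of the stabiliser of the line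
through `(1,1)`, as a subgroup of `GL₂(𝔽_p)` of order `p` (membership = the three entry equations of
the law's hypothesis `hU₂`). -/
theorem exists_unipMid_subgroup :
    ∃ H : Subgroup (GLm p 2),
      (∀ g : GLm p 2, g ∈ H ↔
        (g : Mat p 2) 0 0 + (g : Mat p 2) 0 1 = (g : Mat p 2) 1 0 + (g : Mat p 2) 1 1 ∧
        (g : Mat p 2) 0 0 + (g : Mat p 2) 0 1 = 1 ∧ (g : Mat p 2) 1 1 - (g : Mat p 2) 0 1 = 1) ∧
      Nat.card H = p := by
  obtain ⟨e00, e01, e10, e11⟩ := gl2_one_apply (p := p)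
  -- an explicit element with parameter `t`
  have mk : ∀ t : ZMod p, ∃ u : GLm p 2, (u : Mat p 2) 0 0 = 1 - t ∧ (u : Mat p 2) 0 1 = t ∧
      (u : Mat p 2) 1 0 = -t ∧ (u : Mat p 2) 1 1 = 1 + t := fun t =>
    exists_gl2 (1 - t) t (-t) (1 + t) (by ring_nf; exact one_ne_zero)
  let H : Subgroup (GLm p 2) :=
    { carrier := {g | (g : Mat p 2) 0 0 + (g : Mat p 2) 0 1 = (g : Mat p 2) 1 0 + (g : Mat p 2) 1 1 ∧
        (g : Mat p 2) 0 0 + (g : Mat p 2) 0 1 = 1 ∧ (g : Mat p 2) 1 1 - (g : Mat p 2) 0 1 = 1}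
      mul_mem' := by
        rintro a b ⟨ha, ha1, ha2⟩ ⟨hb, hb1, hb2⟩
        show ((a * b : GLm p 2) : Mat p 2) 0 0 + ((a * b : GLm p 2) : Mat p 2) 0 1
              = ((a * b : GLm p 2) : Mat p 2) 1 0 + ((a * b : GLm p 2) : Mat p 2) 1 1 ∧
            ((a * b : GLm p 2) : Mat p 2) 0 0 + ((a * b : GLm p 2) : Mat p 2) 0 1 = 1 ∧
            ((a * b : GLm p 2) : Mat p 2) 1 1 - ((a * b : GLm p 2) : Mat p 2) 0 1 = 1
        simp only [gl2_mul_apply]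
        refine ⟨?_, ?_, ?_⟩
        · linear_combination ((b : Mat p 2) 0 0 + (b : Mat p 2) 0 1) * ha
            - ((a : Mat p 2) 0 1 - (a : Mat p 2) 1 1) * hb
        · linear_combination ((b : Mat p 2) 0 0 + (b : Mat p 2) 0 1) * ha1 + hb1
            - ((a : Mat p 2) 0 1) * hb
        · linear_combination (-((b : Mat p 2) 0 1)) * ha
            + ((b : Mat p 2) 1 1 - (b : Mat p 2) 0 1) * ha2 + hb2
      one_mem' := by
        show ((1 : GLm p 2) : Mat p 2) 0 0 + ((1 : GLm p 2) : Mat p 2) 0 1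
              = ((1 : GLm p 2) : Mat p 2) 1 0 + ((1 : GLm p 2) : Mat p 2) 1 1 ∧
            ((1 : GLm p 2) : Mat p 2) 0 0 + ((1 : GLm p 2) : Mat p 2) 0 1 = 1 ∧
            ((1 : GLm p 2) : Mat p 2) 1 1 - ((1 : GLm p 2) : Mat p 2) 0 1 = 1
        rw [e00, e01, e10, e11]
        refine ⟨?_, ?_, ?_⟩ <;> ring
      inv_mem' := by
        rintro g ⟨hg, hg1, hg2⟩
        show ((g⁻¹ : GLm p 2) : Mat p 2) 0 0 + ((g⁻¹ : GLm p 2) : Mat p 2) 0 1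
              = ((g⁻¹ : GLm p 2) : Mat p 2) 1 0 + ((g⁻¹ : GLm p 2) : Mat p 2) 1 1 ∧
            ((g⁻¹ : GLm p 2) : Mat p 2) 0 0 + ((g⁻¹ : GLm p 2) : Mat p 2) 0 1 = 1 ∧
            ((g⁻¹ : GLm p 2) : Mat p 2) 1 1 - ((g⁻¹ : GLm p 2) : Mat p 2) 0 1 = 1
        have h00 : (g : Mat p 2) 0 0 = 1 - (g : Mat p 2) 0 1 := by linear_combination hg1
        have h11 : (g : Mat p 2) 1 1 = 1 + (g : Mat p 2) 0 1 := by linear_combination hg2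
        have h10 : (g : Mat p 2) 1 0 = -(g : Mat p 2) 0 1 := by
          linear_combination (-1 : ZMod p) * hg + hg1 - hg2
        obtain ⟨u, u00, u01, u10, u11⟩ := mk (-(g : Mat p 2) 0 1)
        have hgu : g * u = 1 := by
          refine gl2_ext ?_ ?_ ?_ ?_
          · rw [gl2_mul_apply, e00, u00, u10]
            linear_combination (1 + (g : Mat p 2) 0 1) * h00
          · rw [gl2_mul_apply, e01, u01, u11]
            linear_combination (-(g : Mat p 2) 0 1) * h00
          · rw [gl2_mul_apply, e10, u00, u10]
            linear_combination (1 + (g : Mat p 2) 0 1) * h10 + ((g : Mat p 2) 0 1) * h11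
          · rw [gl2_mul_apply, e11, u01, u11]
            linear_combination (-(g : Mat p 2) 0 1) * h10 + (1 - (g : Mat p 2) 0 1) * h11
        rw [inv_eq_of_mul_eq_one_right hgu, u00, u01, u10, u11]
        refine ⟨?_, ?_, ?_⟩ <;> ring }
  have hmem : ∀ g : GLm p 2, g ∈ H ↔
      (g : Mat p 2) 0 0 + (g : Mat p 2) 0 1 = (g : Mat p 2) 1 0 + (g : Mat p 2) 1 1 ∧
        (g : Mat p 2) 0 0 + (g : Mat p 2) 0 1 = 1 ∧ (g : Mat p 2) 1 1 - (g : Mat p 2) 0 1 = 1 :=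
    fun g => Iff.rfl
  refine ⟨H, hmem, ?_⟩
  let f : H → ZMod p := fun g => ((g : GLm p 2) : Mat p 2) 0 1
  have hf : Function.Bijective f := by
    constructor
    · intro g h hgh
      obtain ⟨hg, hg1, hg2⟩ := (hmem _).1 g.2
      obtain ⟨hh, hh1, hh2⟩ := (hmem _).1 h.2
      simp only [f] at hgh
      apply Subtype.ext
      refine gl2_ext ?_ hgh ?_ ?_
      · linear_combination hg1 - hh1 - hgh
      · linear_combination (-1 : ZMod p) * hg + hg1 - hg2 + hh - hh1 + hh2 - hgh
      · linear_combination hg2 - hh2 + hgh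
    · intro t
      obtain ⟨u, u00, u01, u10, u11⟩ := mk t
      refine ⟨⟨u, (hmem u).2 ⟨?_, ?_, ?_⟩⟩, ?_⟩
      · rw [u00, u01, u10, u11]; ring
      · rw [u00, u01]; ring
      · rw [u11, u01]; ring
      · simp only [f]
        exact u01
  rw [Nat.card_eq_of_bijective f hf, Nat.card_zmod]

/-- The lower unipotent group `U_{[e₁]} = {[[1, 0], [y, 1]]} ≤ GL₂(𝔽_p)`, of order `p`. -/
theorem exists_unipLow_subgroup :
    ∃ H : Subgroup (GLm p 2),
      (∀ g : GLm p 2, g ∈ H ↔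
        (g : Mat p 2) 0 1 = 0 ∧ (g : Mat p 2) 0 0 = 1 ∧ (g : Mat p 2) 1 1 = 1) ∧
      Nat.card H = p := by
  obtain ⟨e00, e01, e10, e11⟩ := gl2_one_apply (p := p)
  have mk : ∀ y : ZMod p, ∃ u : GLm p 2, (u : Mat p 2) 0 0 = 1 ∧ (u : Mat p 2) 0 1 = 0 ∧
      (u : Mat p 2) 1 0 = y ∧ (u : Mat p 2) 1 1 = 1 := fun y =>
    exists_gl2 1 0 y 1 (by rw [mul_one, zero_mul, sub_zero]; exact one_ne_zero)
  let H : Subgroup (GLm p 2) :=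
    { carrier := {g | (g : Mat p 2) 0 1 = 0 ∧ (g : Mat p 2) 0 0 = 1 ∧ (g : Mat p 2) 1 1 = 1}
      mul_mem' := by
        rintro a b ⟨ha, ha0, ha1⟩ ⟨hb, hb0, hb1⟩
        show ((a * b : GLm p 2) : Mat p 2) 0 1 = 0 ∧ ((a * b : GLm p 2) : Mat p 2) 0 0 = 1 ∧
            ((a * b : GLm p 2) : Mat p 2) 1 1 = 1
        rw [gl2_mul_apply, gl2_mul_apply, gl2_mul_apply, ha, ha0, ha1, hb, hb0, hb1]
        refine ⟨?_, ?_, ?_⟩ <;> ring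
      one_mem' := ⟨e01, e00, e11⟩
      inv_mem' := by
        rintro g ⟨hg, hg0, hg1⟩
        show ((g⁻¹ : GLm p 2) : Mat p 2) 0 1 = 0 ∧ ((g⁻¹ : GLm p 2) : Mat p 2) 0 0 = 1 ∧
            ((g⁻¹ : GLm p 2) : Mat p 2) 1 1 = 1
        obtain ⟨u, u00, u01, u10, u11⟩ := mk (-(g : Mat p 2) 1 0)
        have hgu : g * u = 1 := by
          refine gl2_ext ?_ ?_ ?_ ?_
          · rw [gl2_mul_apply, e00, u00, u10, hg0, hg]; ring
          · rw [gl2_mul_apply, e01, u01, u11, hg0, hg]; ring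
          · rw [gl2_mul_apply, e10, u00, u10, hg1]; ring
          · rw [gl2_mul_apply, e11, u01, u11, hg1]; ring
        rw [inv_eq_of_mul_eq_one_right hgu, u00, u01, u11]
        exact ⟨rfl, rfl, rfl⟩ }
  have hmem : ∀ g : GLm p 2, g ∈ H ↔
      (g : Mat p 2) 0 1 = 0 ∧ (g : Mat p 2) 0 0 = 1 ∧ (g : Mat p 2) 1 1 = 1 := fun g => Iff.rfl
  refine ⟨H, hmem, ?_⟩
  let f : H → ZMod p := fun g => ((g : GLm p 2) : Mat p 2) 1 0
  have hf : Function.Bijective f := by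
    constructor
    · intro g h hgh
      obtain ⟨hg, hg0, hg1⟩ := (hmem _).1 g.2
      obtain ⟨hh, hh0, hh1⟩ := (hmem _).1 h.2
      simp only [f] at hgh
      apply Subtype.ext
      exact gl2_ext (by rw [hg0, hh0]) (by rw [hg, hh]) hgh (by rw [hg1, hh1])
    · intro y
      obtain ⟨u, u00, u01, u10, u11⟩ := mk y
      exact ⟨⟨u, (hmem u).2 ⟨u01, u00, u11⟩⟩, by simp only [f]; exact u10⟩
  rw [Nat.card_eq_of_bijective f hf, Nat.card_zmod]

/-- **THE DECORATED-SYLOW LAW IS SHARP IN EVERY `GL₂(𝔽_p)`.**  For every prime `p` there are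
subgroups `H₁, H₂, H₃ ≤ GL₂(𝔽_p)` satisfying the six shape hypotheses of
`decoratedSylow_volume_le` verbatim (`U_{xᵢ} ≤ Hᵢ ≤ B_{xᵢ}` at `[e₀], [e₀+e₁], [e₁]`), with the
subgroup TPP and `|H₁||H₂||H₃| = p³(p-1)`: the affine group, `U_{[e₀+e₁]}` and `U_{[e₁]}`. -/
theorem decoratedSylow_volume_sharp :
    ∃ H₁ H₂ H₃ : Subgroup (GLm p 2),
      (∀ h ∈ H₁, (h : Mat p 2) 1 0 = 0) ∧
      (∀ u : GLm p 2, (u : Mat p 2) 1 0 = 0 → (u : Mat p 2) 0 0 = 1 → (u : Mat p 2) 1 1 = 1 →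
        u ∈ H₁) ∧
      (∀ h ∈ H₂, (h : Mat p 2) 0 0 + (h : Mat p 2) 0 1 = (h : Mat p 2) 1 0 + (h : Mat p 2) 1 1) ∧
      (∀ u : GLm p 2,
        (u : Mat p 2) 0 0 + (u : Mat p 2) 0 1 = (u : Mat p 2) 1 0 + (u : Mat p 2) 1 1 →
        (u : Mat p 2) 0 0 + (u : Mat p 2) 0 1 = 1 → (u : Mat p 2) 1 1 - (u : Mat p 2) 0 1 = 1 →
        u ∈ H₂) ∧
      (∀ h ∈ H₃, (h : Mat p 2) 0 1 = 0) ∧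
      (∀ u : GLm p 2, (u : Mat p 2) 0 1 = 0 → (u : Mat p 2) 0 0 = 1 → (u : Mat p 2) 1 1 = 1 →
        u ∈ H₃) ∧
      SubgroupTPP H₁ H₂ H₃ ∧
      Nat.card H₁ * Nat.card H₂ * Nat.card H₃ = p ^ 3 * (p - 1) := by
  obtain ⟨H₁, m1, c1⟩ := exists_affine_subgroup (p := p)
  obtain ⟨H₂, m2, c2⟩ := exists_unipMid_subgroup (p := p)
  obtain ⟨H₃, m3, c3⟩ := exists_unipLow_subgroup (p := p)
  obtain ⟨e00, e01, e10, e11⟩ := gl2_one_apply (p := p)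
  refine ⟨H₁, H₂, H₃, fun h hh => ((m1 h).1 hh).1, fun u h0 _ h1 => (m1 u).2 ⟨h0, h1⟩,
    fun h hh => ((m2 h).1 hh).1, fun u h h1 h2 => (m2 u).2 ⟨h, h1, h2⟩,
    fun h hh => ((m3 h).1 hh).1, fun u h0 h1 h2 => (m3 u).2 ⟨h0, h1, h2⟩, ?_, ?_⟩
  · intro a ha b hb c hc habc
    obtain ⟨ha0, ha1⟩ := (m1 a).1 ha
    obtain ⟨hb, hb1, hb2⟩ := (m2 b).1 hb
    obtain ⟨hc01, hc00, hc11⟩ := (m3 _).1 (H₃.inv_mem hc)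
    have hab : a * b = c⁻¹ := mul_eq_one_iff_eq_inv.1 habc
    -- entry `(1,1)` of `a * b = c⁻¹`: `b₁₁ = 1`, hence `b = 1`
    have h11 := gl2_mul_apply a b 1 1
    rw [hab, hc11, ha0, ha1, zero_mul, zero_add, one_mul] at h11
    have hb01 : (b : Mat p 2) 0 1 = 0 := by linear_combination (-1 : ZMod p) * hb2 - h11
    have hb' : b = 1 :=
      gl2_ext (by rw [e00]; linear_combination hb1 - hb01) (by rw [e01]; exact hb01)
        (by rw [e10]; linear_combination (-1 : ZMod p) * hb + hb1 + h11)
        (by rw [e11]; exact h11.symm)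
    rw [hb', mul_one] at hab
    have ha' : a = 1 :=
      gl2_ext (by rw [e00, hab, hc00]) (by rw [e01, hab, hc01]) (by rw [e10, ha0])
        (by rw [e11, ha1])
    exact ⟨ha', hb', inv_eq_one.1 (hab.symm.trans ha')⟩
  · rw [c1, c2, c3]
    ring

end DecoratedSylowSharp

end Summit.MatrixMultiplication.MatrixMultiplication.Theorems.SubgroupIdentityDesigns.Negative
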